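import Literature.NumberTheory.GaloisRepresentations.PicardCurveGaloisRep
import Literature.NumberTheory.GaloisRepresentations.PstWeilDeligne
import Literature.NumberTheory.PAdicHodge.FontaineDpst
import HarnessLib

/-!
# The `λ`-adic representation of a Picard curve is de Rham at `λ` (Faltings 1989; named fact)

Topic `NumberTheory/GaloisRepresentations`; namespace `Literature.NumberTheory.GaloisRepresentations`.
Companion of the named fact `picardCurve_exists_lambdaAdicRep` (same directory; Upton 2009: the `λ`-adic
representation `ρ` of the Picard curve `C_f : y³ = f(x)` over `K = ℚ(ω)` — unramified at the good
`𝔭 ∤ 3` with geometric-Frobenius trace `j(a_𝔭(f))`, absolutely irreducible for generic `f`), which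
asserts ONLY those three consequences of the construction `ρ = H¹_ét(C_{f,K̄}, ℚ₃) ⊗_{ℤ₃[ω], j} ℚ̄₃`.
This file records the FOURTH consequence that every use of `ρ` in `p`-adic Hodge theoretic arguments
(classicality, Fontaine–Mazur) needs: `ρ` is DE RHAM at the place `λ = (1 - ω)` above `3`, for
Fontaine's pinned datum `PAdicHodge.fontainePstAdicCompletion v 3 hv` — because `H¹_ét(C_{f, K̄_λ}, ℚ₃)`
of the smooth proper curve `C_f` over the `3`-adic field `K_λ` is de Rham (Faltings 1989, the de Rham
comparison theorem `C_dR`; equivalently Tsuji 1999 `C_st` + de Jong's alterations ⟹ potentially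
semistable ⟹ de Rham), and the `ω`-eigenparts of a de Rham `K_λ ⊗ ℚ₃`-linear representation are de
Rham (Fontaine 1994, Exp. III Prop. 1.5.2: sub-objects of `B`-admissible objects).  Since `ρ` is
`∃`-bound inside `picardCurve_exists_lambdaAdicRep`, the only faithful way to state the property is
the STRENGTHENED existence statement below (the original three clauses verbatim, plus the de Rham
clause); `picardCurve_exists_lambdaAdicRep_of_isDeRhamFramed` recovers the original fact from it.

Consumer: crux `PicardMuOrdinary.IrregularClassicality` (stmt-Langlands-13758), line
`slope-free-polarized-limit`, registered stub `stub_picardLambdaAdicRepDeRham` (VERBATIM this fact): the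
geometric de Rham input of the honest classicality heart.

What is NOT here: a proof.  STATUS (review of 2026-08-17, sources open): the statement is correct and
published, and its size is that of a theory.  A discharge needs BOTH
(i) the construction behind the original fact — in the tree the `ρ` of `picardCurve_exists_lambdaAdicRep`
is `FramedRep.dual (picardRho1 …)` (file `PicardLambdaAdicRep`: a `ℤ₃[ω]`-frame of the Tate module
`T₃ Pic(C_{f,K̄})` of the function field `K̄(C_f)`, pushed along `ω ↦ j(ω)²`, then dualised), for which
all three original clauses are PROVED from Weil's trace formula `hW` for the curves `y^p = f(x)` over
finite fields alone (`picardCurve_exists_lambdaAdicRep_of_weil`, file `PicardGoodReductionDeuring`: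
Deuring reduction, Chebotarev, Hasse–Weil for function fields; `hW` is Milne, *Jacobian varieties*,
Thm. 11.1, and is being reduced further in the files `PicardFrobenius*`) — AND
(ii) the `B_dR(K_λ)`-ADMISSIBILITY of `ℚ₃ ⊗ T₃ Pic(C_{f,K̄})` restricted to `Γ_{K_λ}`, `K_λ = ℚ₃(ω)`
(`GaloisRep.IsDeRham` for the constructed period ring `PAdicHodge.bdRPeriodRingData`, which IS the
period ring of the pinned datum, `PAdicHodge.fontainePst_𝔅_eq_bdRPeriodRingData`), i.e. Fontaine's
conjecture `C_dR` for `H¹` of the genus-`3` curve `C_f` over `K_λ` — Faltings 1989, Ch. VIII Thm. 8.1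
(equivalently: Tsuji 1999 `C_st` after semistable reduction, or Colmez's `B_dR`-valued abelian
integrals on `J(C_f)`).  Nothing of (ii) exists in Mathlib or in the tree, and no shortcut of the tree
applies: inertia at `λ` acts on `ρ` through an infinite image (the Hodge–Tate weights of `V₃ J(C_f)`
are `0` and `±1`, both occurring: Hodge–Tate decomposition of abelian varieties, Tate 1967 / Fontaine
1982), so `BdRUnramified` / `BdRFiniteImage` / `fontainePstAdicCompletion_isDeRhamFramed_of_finite_range`
do not reach it, and the plane model `y³ = f(x)` is not smooth modulo `λ` (characteristic `3`:
`∂_y(y³ - f) = 0`), so no good-reduction (crystalline, Fontaine–Messing) argument is available either.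
GIVEN (ii), de Rham-ness passes to the `ω`-eigenpart, to the `ℚ̄₃`-model and to the dual by the
accepted heredity lemmas (Fontaine Exp. III Prop. 1.5.2: files `PstWeilDeligneHeredity`,
`PstWeilDeligneDualDeRham`, in particular `fontainePstAdicCompletion_isDeRhamFramed_dual_toLocal`,
written for this fact).  NOTE for dischargers: `ρ` is `∃`-bound, so the original fact
`picardCurve_exists_lambdaAdicRep` is a COROLLARY of this one
(`picardCurve_exists_lambdaAdicRep_of_isDeRhamFramed` below), not a prerequisite — a proof must rerun
the construction (i) and add (ii) for THAT object; "blocked on the original fact" is vacuous.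
Also not here: the Hodge–Tate weights of `ρ` at the two embeddings `K_λ → ℚ̄₃` (`{0,0,1} | {0,1,1}`
up to the tree's sign convention, from the signature `(2,1)` of the `ℤ[ω]`-action on `H⁰(C_f, Ω¹)`);
potential semistability / the Weil–Deligne representation at `λ`.
-- TODO(general form): `C_dR` — for every smooth proper (even: smooth separated) variety `X` over a
-- `p`-adic field `F` and every `i`, `H^i_ét(X_{F̄}, ℚ_p)` is de Rham (Faltings 1989, Thm. 8.1; Tsuji
-- 1999 + de Jong 1996); needs étale cohomology of varieties as Galois representations, which the tree
-- does not have — for CURVES the tree's function-field Tate module `TateModule (GeomPic …)` is the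
-- `H¹`, and (ii) above is the curve case of this TODO.

References: C. Upton, J. Algebra 322 (2009), Thm. 2.1 and §4 [Upton2009]; G. Faltings, *Crystalline
cohomology and p-adic Galois-representations*, in Algebraic analysis, geometry, and number theory (JHU
Press 1989) 25–80, Ch. VIII "The de Rham conjecture", Thm. 8.1 (read on the held scan of the volume, ed.
J.-I. Igusa, ISBN 9780801838415) [Faltings1989Crystalline]; T. Tsuji, Invent. Math. 137 (1999), Thm. 0.2 [Tsuji1999Cst];
A. J. de Jong, Publ. Math. IHÉS 83 (1996) [DeJong1996]; J.-M. Fontaine, Astérisque 223 (1994), Exp. III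
Prop. 1.5.2 [FontaineAsterisque223III]; J.-P. Serre, J. Tate, Ann. of Math. 88 (1968), Thm. 1
[SerreTate1968GoodReduction]; P. Deligne, SGA 4½ (1977), Rapport §3 [DeligneSGA4half1977].
-/

noncomputable section

open scoped NumberField Polynomial
open NumberField IsDedekindDomain Field Polynomial

namespace Literature.NumberTheory.GaloisRepresentations

/-- **The `λ`-adic Galois representation of a Picard curve, with its de Rham property at `λ`** (named
fact; STRENGTHENS `picardCurve_exists_lambdaAdicRep` by the last clause).  For `f ∈ ℤ[X]` a quartic
separable over `ℚ` and `j : ℚ(ω) →+* ℚ̄₃` there is a framed `ρ : Γ_{ℚ(ω)} → GL₃(ℚ̄₃)` (one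
`ω`-eigenpart of `H¹_ét(C_{f,K̄}, ℚ₃) ⊗ ℚ̄₃`, `C_f : y³ = f(x)`) such that: at every finite `𝔭 ∤ 3`
where `f mod 𝔭` is a separable quartic, `ρ` is unramified with geometric-Frobenius trace
`j(a_𝔭(f))` (`a_𝔭 = picardTrace`; Serre–Tate + Grothendieck–Lefschetz/Weil, as in the original fact);
`ρ` is absolutely irreducible when `12 ∣ #Gal(f/ℚ)` (Schaefer–Zarhin module, as in the original fact);
AND `ρ|_{Γ_{K_v}}` is de Rham for Fontaine's pinned datum at every `v ∣ 3` (Faltings 1989 `C_dR` for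
the smooth proper curve `C_f` over `K_λ`; eigenparts by Fontaine 1994 Exp. III Prop. 1.5.2).  Users take
`(h : picardCurve_exists_lambdaAdicRep_isDeRhamFramed)`.
[cite: Upton2009, Thm. 2.1 and §4]
[cite: Faltings1989Crystalline, Ch. VIII Thm. 8.1 (C_dR: for X smooth and separated over K there is a natural Gal(K̄/K)-linear filtered isomorphism H*(X, Ω•_{X/K}) ⊗_K B_dR ≅ H*(X_K̄, ℚ_p) ⊗ B_dR; closing theorem of the article)]
[cite: Tsuji1999Cst, Thm. 0.2] [cite: FontaineAsterisque223III, Exp. III Prop. 1.5.2]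
[cite: SerreTate1968GoodReduction, Thm. 1] [cite: DeligneSGA4half1977, Rapport §3] -/
def picardCurve_exists_lambdaAdicRep_isDeRhamFramed : Prop :=
  ∀ (f : ℤ[X]), f.natDegree = 4 → (f.map (Int.castRingHom ℚ)).Separable →
    ∀ (j : CyclotomicField 3 ℚ →+* PadicAlgCl 3),
      ∃ ρ : FramedGaloisRep (CyclotomicField 3 ℚ) (PadicAlgCl 3) 3,
        (∀ 𝔭 : HeightOneSpectrum (𝓞 (CyclotomicField 3 ℚ)),
            (3 : 𝓞 (CyclotomicField 3 ℚ)) ∉ 𝔭.asIdeal →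
            (f.map ((Ideal.Quotient.mk 𝔭.asIdeal).comp
              (algebraMap ℤ (𝓞 (CyclotomicField 3 ℚ))))).natDegree = 4 →
            (f.map ((Ideal.Quotient.mk 𝔭.asIdeal).comp
              (algebraMap ℤ (𝓞 (CyclotomicField 3 ℚ))))).Separable →
              ρ.IsUnramifiedAt 𝔭 ∧
              ∀ 𝔓 ∈ 𝔭.primesAbove, ∀ τ : absoluteGaloisGroup (CyclotomicField 3 ℚ),
                IsArithFrobAt (𝓞 (CyclotomicField 3 ℚ)) τ 𝔓 →
                  FramedRep.trace ρ τ⁻¹ = j (picardTrace f 𝔭)) ∧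
        (12 ∣ Nat.card (f.map (Int.castRingHom ℚ)).Gal → FramedRep.IsAbsolutelyIrreducible ρ) ∧
        ∀ (v : HeightOneSpectrum (𝓞 (CyclotomicField 3 ℚ)))
          (hv : ((3 : ℕ) : 𝓞 (CyclotomicField 3 ℚ)) ∈ v.asIdeal),
          (PAdicHodge.fontainePstAdicCompletion v 3 hv).IsDeRhamFramed (ρ.toLocal v)

/-- The strengthened fact gives back the original `picardCurve_exists_lambdaAdicRep` (drop the de Rham
clause). [folklore] -/
theorem picardCurve_exists_lambdaAdicRep_of_isDeRhamFramed
    (h : picardCurve_exists_lambdaAdicRep_isDeRhamFramed) : picardCurve_exists_lambdaAdicRep := by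
  intro f hdeg hsep j
  obtain ⟨ρ, hρ, hirr, -⟩ := h f hdeg hsep j
  exact ⟨ρ, hρ, hirr⟩

end Literature.NumberTheory.GaloisRepresentations

end
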